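import Summits.CriticalPhenomena.CardyFormulaZ2.Theorems.CardyComplexConeParafermionToSLESixFamiliesDiamondArgumentPrinciple
import Summits.CriticalPhenomena.CardyFormulaZ2.Theorems.CardyComplexConeParafermionToSLESixFamiliesDiamondIdentifyPotentialPh
import Summits.CriticalPhenomena.CardyFormulaZ2.Theorems.CardyComplexConeParafermionToSLESixFamiliesDiamondBoundaryDartPhase
import Summits.CriticalPhenomena.CardyFormulaZ2.Theorems.CardyComplexConeParafermionToSLESixFamiliesDiamondArcsConnected
import Summits.CriticalPhenomena.CardyFormulaZ2.Theorems.CardyComplexConeParafermionToSLESixFamiliesDiamondExactPotentialTracePh3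
import HarnessLib

/-!
# Line `potential-darboux-picard-diamond` (crux `ParafermionToSLESixFamilies`, stmt-CriticalPhenomena-11389): what is PROVED — the exact
# potential with its boundary trace (S1), and N + I on marked diamonds from the collar statement alone (S1 ∘ S2 ∘ S4′)

Lead c5, after wave 4 (2026-08-17). The line `potential-darboux-picard-diamond` of the crux integrates the closed spin-`1/3` corner form of
the bond-`ℤ²` percolation exploration into an exact lattice potential (S1), identifies its scaling limit on a marked diamond by Darboux's
theorem for convex targets (S2) applied through the Riemann map, and the boundary identification `(G′)³ = c·ψ′/ψ` (S4′). With waves 1–4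
landed (S1: p138726 (E), p162076 `stub_boundaryDartPhase`, p157908 `stub_diamondArcsConnected`, p158589 `stub_exactPotentialTracePh3`; S2:
p139330; S4′: p153682 over p151443 and p144695), two sorry-free statements of the line are theorems and are recorded here by name:

* `exactPotentialTracePh_holds : ExactPotentialTracePh` — along every admissible family of every marked diamond: exact potential pairs exist
  eventually, and the renormalised face potential `δ^{2/3}Ψ` has the phase-anchored boundary trace (DIR/TURN/LOW) of `…DiamondDefs` §4;
* `potentialConformalLimit_of_closedPrecompactness : ClosedPrecompactness → PotentialConformalLimit` — GIVEN the collar / class /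
  non-degeneracy statement S3 (asymptotic equicontinuity on the closed diamond, subsequential limits holomorphic or antiholomorphic, one free
  segment of positive touch mass — the line's carrier of the inputs N and X1, blocked on `IkhlefPonsaingFirstPassage`, `UniformInnerEnvelope`,
  stmt-11385, stmt-11387), every subsequential limit of `δ^{2/3}Ψ` on a marked diamond is the conformal map with `(G′)³ = c·ψ′/ψ`, `c ≠ 0`,
  for every chordal uniformizer: non-degeneracy N and identification I (DCS Conj. 8.7, integrated family form) on diamonds, conditionally.

Both are registered helper statements of the crux item; nothing else is declared here.
-/

noncomputable section

namespace Summit.CriticalPhenomena.CardyFormulaZ2.Cruxes.ParafermionToSLESixFamilies.PotentialDarbouxPicardDiamond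

/-- **S1 of the line, proved**: the exact potential of the closed spin-`1/3` corner form and its phase-anchored boundary trace along every
admissible family of every marked diamond (composition of the landed `stub_exactPotentialTracePh3`, `stub_boundaryDartPhase`,
`stub_diamondArcsConnected`). -/
theorem exactPotentialTracePh_holds : ExactPotentialTracePh :=
  stub_exactPotentialTracePh3 stub_boundaryDartPhase stub_diamondArcsConnected

/-- **N + I on marked diamonds from the collar statement alone**: `ClosedPrecompactness → PotentialConformalLimit` (the landed engine
`stub_identifyPotentialPh` fed with the proved S1 `exactPotentialTracePh_holds` and S2 `stub_argumentPrinciple`). -/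
theorem potentialConformalLimit_of_closedPrecompactness : ClosedPrecompactness → PotentialConformalLimit :=
  stub_identifyPotentialPh exactPotentialTracePh_holds stub_argumentPrinciple

end Summit.CriticalPhenomena.CardyFormulaZ2.Cruxes.ParafermionToSLESixFamilies.PotentialDarbouxPicardDiamond

end
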